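import Literature.MathematicalPhysics.QuantumFieldTheory.Balaban1983to89.B6FaceInterpolation

/-!
# `Balaban1983to89.B6Lemma24TwoScaleComposite` — T. Bałaban, *Propagators and renormalization transformations for lattice gauge theories. II*,
# Commun. Math. Phys. **96** (1984) 223–250 [Balaban1984PropagatorsII], (2.89) p. 239 («B^j(Λ) = □̃ ∩ B^{j+1}(Λ_{j+1})»: the TWO-LEVEL CUBE) with (2.123)–(2.127)
# pp. 244–245: **COMPOSITE BLOCKS ON b06's ℤᵈ CARRIER** — a block of side `N = n·L` (a `(j+1)`-position) read as the union of its `L^d` sub-blocks of side `n`: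
# its inner bonds, its last and first layers, and the bonds inside those layers, in terms of the sub-blocks' inner bonds and the internal small faces

statement-level skeleton of published theorems with citation tags; proofs where landed; nothing here is a claim about the Yang–Mills mass gap

PDF held: `paper:balaban1984-cmp96-propagators-rt-ii` (journal page = PDF page + 222), pp. 239, 244–245 (text layer, `lit read … --pages 17-28`, 2026-08-28).

CITATION HEADER (lean-in-tree rule).  Cell `pub-ymgap` (Track A, HUMAN RULING D-0062), node N10 [B13] lane owner `pub-ymgap-dag-n10-c` (g17), ROAD «C» station C6a
(design `HOME/pub-ymgap-dag-n10-c/C6-DESIGN.md`; bus INBOX 2026-08-28T16:55Z), filed `--supports stmt-QuantumFields-27364` (count-neutral helper).  WHY: the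
Lemma-2.4 letter of `B6SectADeltaACoerciveReductionV1` for a cube meeting `Ω_{j+1}` (print's two-level cube (2.89)) is assembled from pv09's per-face∕per-block
lemmas at TWO scales; the interface face between a `(j+1)`-position `Y₀` of the level-`j` region and a big block `Y` is read at scale `N` (`B6Lemma24Printed.
face_split`, gauge-free), which needs the inner bonds and the boundary layers of the COMPOSITE `Y₀` in terms of its `n`-sub-blocks — the bookkeeping below.
IMPORTS `B6FaceInterpolation` (pv09: `lastLayer`, `firstLayer`, `bondsIn`; through it `B6TreeGaugePoincare.innerBonds`, `B6Elimination.block ∕ corner`,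
`B6BondElimination.unitVec`); nothing restated.

THE PRINT (verbatim, p. 239): *«We define B^j(Λ) = □̃ ∩ B^{j+1}(Λ_{j+1}), (2.89) and we take Q′*aQ′, Q*aQ equal to Q′*_{j+1}a_{j+1}Q′_{j+1}, Q*_{j+1}a_{j+1}Q_{j+1} on B^j(Λ), and to
Q′*_ja_jQ′_j, Q*_ja_jQ_j on □̃ ∖ B^j(Λ)»* — two block sizes `Lʲ` and `L^{j+1} = L·Lʲ` in one cube.

WHAT IS DEFINED (bodies displayed) AND PROVED (sorry-free; standard axioms).  For `n ≥ 1`, `L ≥ 1`, `Y₀ ∈ nℤᵈ`: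
* `subCorners n L Y₀` — the corners `s ∈ nℤᵈ` of the `n`-sub-blocks of the block `B_{nL}(Y₀)` (as `(block (n*L) Y₀).image (corner n)`); `mem_subCorners_iff`,
  `block_sub_subset` (`B_n(s) ⊆ B_{nL}(Y₀)`), `corner_mem_subCorners`, `sum_block_big_eq_sum_subCorners` (`Σ_{x∈B_{nL}(Y₀)} f = Σ_{s} Σ_{x∈B_n(s)} f`).
* ★ `innerBonds_big_subset` — every inner bond of `B_{nL}(Y₀)` is an inner bond of its sub-block `s = corner n` or a bond of the internal small face `(s, μ)` (last layer
  of `s` in direction `μ` with `s + n e_μ` again a sub-corner); ★ `sum_innerBonds_big_le` — for `f ≥ 0`,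
  `Σ_{innerBonds (nL) Y₀} f ≤ Σ_s Σ_{innerBonds n s} f + Σ_s Σ_μ [s + n e_μ ∈ subCorners] Σ_{z ∈ lastLayer n s μ} f (z, μ)`.
* ★ `lastLayer_big_subset` ∕ `firstLayer_big_subset` (the big layers lie in the boundary sub-blocks' layers), ★ `sum_bondsIn_lastLayer_big_le` ∕
  `sum_bondsIn_firstLayer_big_le` — for `f ≥ 0`, the bonds INSIDE the last (first) big layer are inner bonds of boundary sub-blocks or bonds of internal small faces
  between boundary sub-blocks: `Σ_{bondsIn (lastLayer (nL) Y₀ μ)} f ≤ Σ_s Σ_{innerBonds n s} f + Σ_s Σ_ν [s + n e_ν ∈ subCorners] Σ_{z ∈ lastLayer n s ν} f (z, ν)`.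
* §4 (v1.1, append-only): `lastLayer_sub_subset_big`, `faceBonds_sub_subset_big`, `sum_lastLayer_sub_le_big` — the interface small faces are pieces of the big face
  (the inclusion the two-scale coverage step uses; §3 has the converse).
HONEST SCOPE.  Finset bookkeeping on ℤᵈ; no inequality of the paper; NOT a node discharge; count-neutral; nothing continuum ∕ OS ∕ mass gap ∕ Clay.
-/

namespace Literature.MathematicalPhysics.QuantumFieldTheory.Balaban1983to89.B6Lemma24TwoScaleComposite

open Finset
open B6Elimination (block mem_block corner corner_apply corner_le lt_corner_add mem_block_corner corner_eq_of_mem_block corner_eq_self_of_dvd)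
open B6BondElimination (unitVec unitVec_apply add_unitVec_apply add_smul_unitVec_apply)
open B6TreeGaugePoincare (Cfg innerBonds mem_innerBonds)
open B6FaceInterpolation (lastLayer firstLayer bondsIn mem_lastLayer mem_firstLayer mem_bondsIn)

noncomputable section

variable {d : ℕ} {n L : ℕ}

/-! ## §1. Sub-blocks of a composite block -/

/-- the corners of the `n`-sub-blocks of the big block `B_{nL}(Y₀)`. [cite: Balaban1984PropagatorsII, (2.89) p.239] -/
def subCorners (n L : ℕ) (Y₀ : Fin d → ℤ) : Finset (Fin d → ℤ) := (block (n * L) Y₀).image (corner n)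

/-- membership. [cite: Balaban1984PropagatorsII, (2.89) p.239; folklore] -/
theorem mem_subCorners_iff {Y₀ s : Fin d → ℤ} : s ∈ subCorners n L Y₀ ↔ ∃ z ∈ block (n * L) Y₀, corner n z = s := by
  simp only [subCorners, mem_image]

/-- a sub-block lies inside the big block (for `Y₀ ∈ nℤᵈ`). [cite: Balaban1984PropagatorsII, (2.89) p.239; folklore] -/
theorem block_sub_subset (hn : 1 ≤ n) {Y₀ : Fin d → ℤ} (hY : ∀ i, (n : ℤ) ∣ Y₀ i) {s : Fin d → ℤ} (hs : s ∈ subCorners n L Y₀) :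
    block n s ⊆ block (n * L) Y₀ := by
  obtain ⟨z, hz, rfl⟩ := mem_subCorners_iff.1 hs
  intro x hx
  rw [mem_block] at hz hx ⊢
  intro i
  obtain ⟨hz1, hz2⟩ := hz i
  obtain ⟨hx1, hx2⟩ := hx i
  have hn0 : (0 : ℤ) < n := by exact_mod_cast hn
  obtain ⟨q, hq⟩ := hY i
  rw [corner_apply] at hx1 hx2
  -- `q ≤ z i / n ≤ q + L − 1`
  have h1 : q ≤ z i / (n : ℤ) := Int.le_ediv_of_mul_le hn0 (by rw [mul_comm]; linarith)
  have h2 : z i / (n : ℤ) < q + L := Int.ediv_lt_of_lt_mul hn0 (by push_cast at hz2 ⊢; nlinarith)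
  constructor
  · nlinarith
  · push_cast
    have : (n : ℤ) * (z i / (n : ℤ)) + n ≤ (n : ℤ) * (q + L) := by nlinarith
    nlinarith

/-- the corner of a point of the big block is a sub-corner. [cite: Balaban1984PropagatorsII, (2.89) p.239; folklore] -/
theorem corner_mem_subCorners {Y₀ z : Fin d → ℤ} (hz : z ∈ block (n * L) Y₀) : corner n z ∈ subCorners n L Y₀ :=
  mem_subCorners_iff.2 ⟨z, hz, rfl⟩

/-- sums over the big block split over the sub-blocks. [cite: Balaban1984PropagatorsII, (2.89) p.239; folklore] -/
theorem sum_block_big_eq_sum_subCorners (hn : 1 ≤ n) {Y₀ : Fin d → ℤ} (hY : ∀ i, (n : ℤ) ∣ Y₀ i) (f : (Fin d → ℤ) → ℝ) :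
    ∑ x ∈ block (n * L) Y₀, f x = ∑ s ∈ subCorners n L Y₀, ∑ x ∈ block n s, f x := by
  classical
  have hn0 : 0 < n := hn
  have hdisj : ((subCorners n L Y₀ : Finset (Fin d → ℤ)) : Set (Fin d → ℤ)).PairwiseDisjoint (block n) := by
    intro s hs s' hs' hss'
    obtain ⟨z, -, rfl⟩ := mem_subCorners_iff.1 hs
    obtain ⟨z', -, rfl⟩ := mem_subCorners_iff.1 hs'
    refine disjoint_left.2 fun x hx hx' => hss' ?_
    rw [← corner_eq_of_mem_block hn0 hx, ← corner_eq_of_mem_block hn0 hx']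
  rw [← sum_biUnion hdisj]
  apply sum_congr _ fun _ _ => rfl
  ext x
  constructor
  · intro hx
    exact mem_biUnion.2 ⟨corner n x, corner_mem_subCorners hx, mem_block_corner hn0 x⟩
  · intro hx
    obtain ⟨s, hs, hxs⟩ := mem_biUnion.1 hx
    exact block_sub_subset hn hY hs hxs

/-- sums of a nonnegative function: over a subset of `A ∪ B` at most the sum over `A` plus the sum over `B` (private helper). [folklore] -/
private theorem sum_le_sum_add_sum_of_subset_union {α : Type*} [DecidableEq α] {S A B : Finset α} (h : S ⊆ A ∪ B) {f : α → ℝ} (hf : ∀ a, 0 ≤ f a) :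
    ∑ a ∈ S, f a ≤ ∑ a ∈ A, f a + ∑ a ∈ B, f a := by
  calc ∑ a ∈ S, f a ≤ ∑ a ∈ A ∪ B, f a := sum_le_sum_of_subset_of_nonneg h fun a _ _ => hf a
    _ ≤ ∑ a ∈ A ∪ B, f a + ∑ a ∈ A ∩ B, f a := le_add_of_nonneg_right (sum_nonneg fun a _ => hf a)
    _ = ∑ a ∈ A, f a + ∑ a ∈ B, f a := sum_union_inter

/-! ## §2. The inner bonds of a composite block -/

/-- the bonds of the small face `(s, μ)`: `⟨z, z + e_μ⟩` with `z` in the last layer of `B_n(s)` in direction `μ`. [cite: Balaban1984PropagatorsII, p.244 (Δ′)] -/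
def faceBonds (n : ℕ) (s : Fin d → ℤ) (μ : Fin d) : Finset ((Fin d → ℤ) × Fin d) := (lastLayer n s μ).image fun z => (z, μ)

/-- membership. [cite: Balaban1984PropagatorsII, p.244; folklore] -/
theorem mem_faceBonds {s : Fin d → ℤ} {μ : Fin d} {b : (Fin d → ℤ) × Fin d} : b ∈ faceBonds n s μ ↔ b.1 ∈ lastLayer n s μ ∧ b.2 = μ := by
  constructor
  · intro h
    obtain ⟨z, hz, rfl⟩ := mem_image.1 h
    exact ⟨hz, rfl⟩
  · rintro ⟨h1, h2⟩
    exact mem_image.2 ⟨b.1, h1, by rw [← h2]⟩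

/-- sums over the face bonds. [cite: Balaban1984PropagatorsII, p.244; folklore] -/
theorem sum_faceBonds (s : Fin d → ℤ) (μ : Fin d) (f : (Fin d → ℤ) × Fin d → ℝ) : ∑ b ∈ faceBonds n s μ, f b = ∑ z ∈ lastLayer n s μ, f (z, μ) := by
  rw [faceBonds, sum_image fun z _ z' _ h => (Prod.mk.inj h).1]

/-- the INTERNAL small faces of the composite block: `(s, μ)` with `s` and `s + n e_μ` both sub-corners; their bonds. [cite: Balaban1984PropagatorsII, (2.89) p.239] -/
def internalFaceBonds (n L : ℕ) (Y₀ : Fin d → ℤ) : Finset ((Fin d → ℤ) × Fin d) :=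
  (subCorners n L Y₀).biUnion fun s => (univ.filter fun μ : Fin d => s + (n : ℤ) • unitVec μ ∈ subCorners n L Y₀).biUnion (faceBonds n s)

/-- `Σ_{⋃ᵢ tᵢ} g ≤ Σᵢ Σ_{tᵢ} g` for nonnegative `g` (multiplicities only help; private helper). [folklore] -/
private theorem sum_biUnion_le_of_nonneg {ι β : Type*} [DecidableEq ι] [DecidableEq β] (I : Finset ι) (t : ι → Finset β) {g : β → ℝ} (hg : ∀ b, 0 ≤ g b) :
    ∑ b ∈ I.biUnion t, g b ≤ ∑ i ∈ I, ∑ b ∈ t i, g b := by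
  induction I using Finset.induction_on with
  | empty => simp
  | insert a I ha ih =>
    rw [biUnion_insert, sum_insert ha]
    exact (sum_le_sum_add_sum_of_subset_union (subset_of_eq rfl) hg).trans (add_le_add le_rfl ih)

/-- the sum over the internal face bonds, as an iterated sum (nonnegative integrand, `≤`). [cite: Balaban1984PropagatorsII, (2.89) p.239; folklore] -/
theorem sum_internalFaceBonds_le (Y₀ : Fin d → ℤ) {f : (Fin d → ℤ) × Fin d → ℝ} (hf : ∀ b, 0 ≤ f b) :
    ∑ b ∈ internalFaceBonds n L Y₀, f b ≤
      ∑ s ∈ subCorners n L Y₀, ∑ μ ∈ univ.filter (fun μ : Fin d => s + (n : ℤ) • unitVec μ ∈ subCorners n L Y₀), ∑ z ∈ lastLayer n s μ, f (z, μ) := by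
  classical
  refine (sum_biUnion_le_of_nonneg _ _ hf).trans (sum_le_sum fun s _ => (sum_biUnion_le_of_nonneg _ _ hf).trans (le_of_eq ?_))
  exact sum_congr rfl fun μ _ => sum_faceBonds s μ f

/-- ★ **an inner bond of the composite block is an inner bond of its sub-block or a bond of an internal small face.** [cite: Balaban1984PropagatorsII, (2.89) p.239, p.244] -/
theorem innerBonds_big_subset (hn : 1 ≤ n) (Y₀ : Fin d → ℤ) :
    innerBonds (n * L) Y₀ ⊆ (subCorners n L Y₀).biUnion (innerBonds n) ∪ internalFaceBonds n L Y₀ := by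
  classical
  intro b hb
  obtain ⟨hb1, hb2⟩ := mem_innerBonds.1 hb
  have hn0 : 0 < n := hn
  set s := corner n b.1 with hsdef
  have hs : s ∈ subCorners n L Y₀ := corner_mem_subCorners hb1
  have hzs : b.1 ∈ block n s := mem_block_corner hn0 b.1
  by_cases h : b.1 b.2 + 1 < s b.2 + n
  · exact mem_union_left _ (mem_biUnion.2 ⟨s, hs, mem_innerBonds.2 ⟨hzs, h⟩⟩)
  · -- last layer of `s` in direction `b.2`, and the next sub-block is again inside the big block
    have hlt := (mem_block.1 hzs b.2).2
    have heq : b.1 b.2 = s b.2 + n - 1 := by omega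
    have hlast : b.1 ∈ lastLayer n s b.2 := mem_lastLayer.2 ⟨hzs, heq⟩
    have hnext : b.1 + unitVec b.2 ∈ block (n * L) Y₀ := by
      rw [mem_block] at hb1 ⊢
      intro i
      rw [add_unitVec_apply]
      obtain ⟨h1, h2⟩ := hb1 i
      by_cases hi : i = b.2
      · subst hi; rw [if_pos rfl]; constructor <;> omega
      · rw [if_neg hi]; constructor <;> omega
    have hcorner : corner n (b.1 + unitVec b.2) = s + (n : ℤ) • unitVec b.2 := by
      funext i
      rw [corner_apply, add_unitVec_apply, add_smul_unitVec_apply, hsdef, corner_apply]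
      by_cases hi : i = b.2
      · rw [if_pos hi, if_pos hi, hi]
        have hn' : (n : ℤ) ≠ 0 := by exact_mod_cast hn0.ne'
        have heq' : b.1 b.2 = (n : ℤ) * (b.1 b.2 / (n : ℤ)) + n - 1 := by rw [hsdef, corner_apply] at heq; exact heq
        have hz : b.1 b.2 + 1 = (n : ℤ) * (b.1 b.2 / (n : ℤ) + 1) := by linarith [heq']
        rw [hz, Int.mul_ediv_cancel_left _ hn']
        ring
      · rw [if_neg hi, if_neg hi, add_zero, add_zero]
    have hs' : s + (n : ℤ) • unitVec b.2 ∈ subCorners n L Y₀ := by rw [← hcorner]; exact corner_mem_subCorners hnext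
    refine mem_union_right _ (mem_biUnion.2 ⟨s, hs, mem_biUnion.2 ⟨b.2, mem_filter.2 ⟨mem_univ _, hs'⟩, mem_faceBonds.2 ⟨hlast, rfl⟩⟩⟩)

/-- disjointness of the sub-blocks' inner-bond sets. [cite: Balaban1984PropagatorsII, (2.89) p.239; folklore] -/
theorem pairwiseDisjoint_innerBonds_sub (hn : 1 ≤ n) (Y₀ : Fin d → ℤ) :
    ((subCorners n L Y₀ : Finset (Fin d → ℤ)) : Set (Fin d → ℤ)).PairwiseDisjoint (innerBonds n) := by
  intro s hs s' hs' hss'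
  obtain ⟨z, -, rfl⟩ := mem_subCorners_iff.1 hs
  obtain ⟨z', -, rfl⟩ := mem_subCorners_iff.1 hs'
  refine disjoint_left.2 fun b hb hb' => hss' ?_
  have h1 := (mem_innerBonds.1 hb).1
  have h2 := (mem_innerBonds.1 hb').1
  rw [← corner_eq_of_mem_block hn h1, ← corner_eq_of_mem_block hn h2]

/-- ★ **the inner-bond sum of a composite block is bounded by the sub-blocks' inner sums plus the internal small faces' layer sums** (nonnegative integrand).
[cite: Balaban1984PropagatorsII, (2.89) p.239, (2.123)–(2.127) pp.244–245] -/
theorem sum_innerBonds_big_le (hn : 1 ≤ n) (Y₀ : Fin d → ℤ) {f : (Fin d → ℤ) × Fin d → ℝ} (hf : ∀ b, 0 ≤ f b) :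
    ∑ b ∈ innerBonds (n * L) Y₀, f b ≤
      ∑ s ∈ subCorners n L Y₀, ∑ b ∈ innerBonds n s, f b +
        ∑ s ∈ subCorners n L Y₀, ∑ μ ∈ univ.filter (fun μ : Fin d => s + (n : ℤ) • unitVec μ ∈ subCorners n L Y₀), ∑ z ∈ lastLayer n s μ, f (z, μ) := by
  classical
  refine (sum_le_sum_add_sum_of_subset_union (innerBonds_big_subset hn Y₀) hf).trans (add_le_add ?_ (sum_internalFaceBonds_le Y₀ hf))
  rw [sum_biUnion (pairwiseDisjoint_innerBonds_sub hn Y₀)]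

/-! ## §3. The last and first layers of a composite block -/

/-- ★ **the last layer of the composite block in direction `μ` lies in the last layers of its boundary sub-blocks** (those with `s_μ = Y₀_μ + nL − n`).
[cite: Balaban1984PropagatorsII, p.244 (Δ′); (2.89) p.239] -/
theorem lastLayer_big_subset (hn : 1 ≤ n) {Y₀ : Fin d → ℤ} (hY : ∀ i, (n : ℤ) ∣ Y₀ i) (μ : Fin d) {x : Fin d → ℤ} (hx : x ∈ lastLayer (n * L) Y₀ μ) :
    x ∈ lastLayer n (corner n x) μ ∧ corner n x ∈ subCorners n L Y₀ := by
  obtain ⟨hxb, hxμ⟩ := mem_lastLayer.1 hx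
  refine ⟨mem_lastLayer.2 ⟨mem_block_corner hn x, ?_⟩, corner_mem_subCorners hxb⟩
  -- `x_μ = Y₀_μ + nL − 1` and `n ∣ Y₀_μ` ⇒ the sub-block's last layer
  have h1 := corner_le hn x μ
  have h2 := lt_corner_add hn x μ
  rw [corner_apply] at h1 h2 ⊢
  obtain ⟨q, hq⟩ := hY μ
  have hn0 : (0 : ℤ) < n := by exact_mod_cast hn
  -- `x μ + 1 = Y₀ μ + nL` is a multiple of `n`
  have hdiv : (n : ℤ) ∣ x μ + 1 := ⟨q + L, by push_cast at hxμ ⊢; rw [hq] at hxμ; linarith⟩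
  obtain ⟨r, hr⟩ := hdiv
  have : x μ / (n : ℤ) = r - 1 := by
    have hx' : x μ = (n - 1) + (n : ℤ) * (r - 1) := by linarith
    rw [hx', Int.add_mul_ediv_left _ _ hn0.ne', Int.ediv_eq_zero_of_lt (by omega) (by omega), zero_add]
  rw [this]; linarith

/-- ★ **bonds inside the last big layer are inner bonds of boundary sub-blocks or bonds of internal small faces** — hence their (nonnegative) sum is bounded by the
sub-blocks' inner sums plus the internal faces' layer sums. [cite: Balaban1984PropagatorsII, p.244 (Δ′), (2.126)–(2.127) p.245; (2.89) p.239] -/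
theorem sum_bondsIn_lastLayer_big_le (hn : 1 ≤ n) (Y₀ : Fin d → ℤ) (μ : Fin d) {f : (Fin d → ℤ) × Fin d → ℝ} (hf : ∀ b, 0 ≤ f b) :
    ∑ b ∈ bondsIn (lastLayer (n * L) Y₀ μ), f b ≤
      ∑ s ∈ subCorners n L Y₀, ∑ b ∈ innerBonds n s, f b +
        ∑ s ∈ subCorners n L Y₀, ∑ ν ∈ univ.filter (fun ν : Fin d => s + (n : ℤ) • unitVec ν ∈ subCorners n L Y₀), ∑ z ∈ lastLayer n s ν, f (z, ν) := by
  classical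
  -- such a bond is an inner bond of the big block (both end points in the big block, transverse to `μ`… or not: either way `z + e_ν` lies in the block)
  have hsub : bondsIn (lastLayer (n * L) Y₀ μ) ⊆ innerBonds (n * L) Y₀ := by
    intro b hb
    obtain ⟨h1, h2⟩ := mem_bondsIn.1 hb
    have hb1 := (mem_lastLayer.1 h1).1
    have hb2 := (mem_lastLayer.1 h2).1
    refine mem_innerBonds.2 ⟨hb1, ?_⟩
    have := (mem_block.1 hb2 b.2).2
    rw [add_unitVec_apply, if_pos rfl] at this
    omega
  exact (sum_le_sum_of_subset_of_nonneg hsub fun b _ _ => hf b).trans (sum_innerBonds_big_le hn Y₀ hf)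

/-- ★ the same for the FIRST big layer: bonds inside the first layer (direction `μ`) of the composite block `Y₁ = Y + nL·e_μ` are inner bonds of `Y₁`, hence bounded by
the sub-blocks' inner sums plus the internal faces' layer sums of `Y₁`. [cite: Balaban1984PropagatorsII, p.244 (Δ″); (2.89) p.239] -/
theorem sum_bondsIn_firstLayer_big_le (hn : 1 ≤ n) (μ : Fin d) {Y Y₁ : Fin d → ℤ} (hY₁ : Y₁ = Y + ((n * L : ℕ) : ℤ) • unitVec μ)
    {f : (Fin d → ℤ) × Fin d → ℝ} (hf : ∀ b, 0 ≤ f b) :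
    ∑ b ∈ bondsIn (firstLayer (n * L) Y μ), f b ≤
      ∑ s ∈ subCorners n L Y₁, ∑ b ∈ innerBonds n s, f b +
        ∑ s ∈ subCorners n L Y₁, ∑ ν ∈ univ.filter (fun ν : Fin d => s + (n : ℤ) • unitVec ν ∈ subCorners n L Y₁), ∑ z ∈ lastLayer n s ν, f (z, ν) := by
  classical
  have hsub : bondsIn (firstLayer (n * L) Y μ) ⊆ innerBonds (n * L) Y₁ := by
    intro b hb
    obtain ⟨h1, h2⟩ := mem_bondsIn.1 hb
    obtain ⟨hb1, -⟩ := mem_firstLayer.1 h1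
    obtain ⟨hb2, -⟩ := mem_firstLayer.1 h2
    rw [← hY₁] at hb1 hb2
    refine mem_innerBonds.2 ⟨hb1, ?_⟩
    have := (mem_block.1 hb2 b.2).2
    rw [add_unitVec_apply, if_pos rfl] at this
    omega
  exact (sum_le_sum_of_subset_of_nonneg hsub fun b _ _ => hf b).trans (sum_innerBonds_big_le hn Y₁ hf)

/-! ## §4 (v1.1, append-only). The converse inclusion used by the two-scale coverage: boundary sub-blocks' last layers lie in the big last layer -/

/-- for a `μ`-boundary sub-corner `s` of the composite block (`s_μ + n = Y₀_μ + nL`), the last layer of `B_n(s)` in direction `μ` lies in the last layer of `B_{nL}(Y₀)`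
(the interface small faces ARE pieces of the big face). [cite: Balaban1984PropagatorsII, p.244 (Δ′); (2.89) p.239] -/
theorem lastLayer_sub_subset_big (hn : 1 ≤ n) {Y₀ : Fin d → ℤ} (hY : ∀ i, (n : ℤ) ∣ Y₀ i) {s : Fin d → ℤ} (hs : s ∈ subCorners n L Y₀) (μ : Fin d)
    (hbd : s μ + n = Y₀ μ + ((n * L : ℕ) : ℤ)) : lastLayer n s μ ⊆ lastLayer (n * L) Y₀ μ := by
  intro x hx
  obtain ⟨hxs, hxμ⟩ := mem_lastLayer.1 hx
  exact mem_lastLayer.2 ⟨block_sub_subset hn hY hs hxs, by omega⟩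

/-- … hence the interface small face's bonds are bonds of the big face: `faceBonds n s μ ⊆ faceBonds (nL) Y₀ μ`. [cite: Balaban1984PropagatorsII, p.244 (Δ′); (2.89) p.239] -/
theorem faceBonds_sub_subset_big (hn : 1 ≤ n) {Y₀ : Fin d → ℤ} (hY : ∀ i, (n : ℤ) ∣ Y₀ i) {s : Fin d → ℤ} (hs : s ∈ subCorners n L Y₀) (μ : Fin d)
    (hbd : s μ + n = Y₀ μ + ((n * L : ℕ) : ℤ)) : faceBonds n s μ ⊆ faceBonds (n * L) Y₀ μ := by
  intro b hb
  obtain ⟨h1, h2⟩ := mem_faceBonds.1 hb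
  exact mem_faceBonds.2 ⟨lastLayer_sub_subset_big hn hY hs μ hbd h1, h2⟩

/-- the sum over an interface small face's last layer is at most the big face's last-layer sum (nonnegative integrand).
[cite: Balaban1984PropagatorsII, p.244 (Δ′); (2.89) p.239] -/
theorem sum_lastLayer_sub_le_big (hn : 1 ≤ n) {Y₀ : Fin d → ℤ} (hY : ∀ i, (n : ℤ) ∣ Y₀ i) {s : Fin d → ℤ} (hs : s ∈ subCorners n L Y₀) (μ : Fin d)
    (hbd : s μ + n = Y₀ μ + ((n * L : ℕ) : ℤ)) {g : (Fin d → ℤ) → ℝ} (hg : ∀ x, 0 ≤ g x) :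
    ∑ x ∈ lastLayer n s μ, g x ≤ ∑ x ∈ lastLayer (n * L) Y₀ μ, g x :=
  sum_le_sum_of_subset_of_nonneg (lastLayer_sub_subset_big hn hY hs μ hbd) fun x _ _ => hg x

end

end Literature.MathematicalPhysics.QuantumFieldTheory.Balaban1983to89.B6Lemma24TwoScaleComposite
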